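import Summits.AtomisticToContinuum.HydrodynamicLimit.Theorems.CollisionIsometryCLTAdaptedWeightCLTTLPastDampingMasses
import Summits.AtomisticToContinuum.HydrodynamicLimit.Theorems.CollisionIsometryCLTAdaptedWeightCLTTLColumnDepolarisationBounds
import Summits.AtomisticToContinuum.HydrodynamicLimit.Theorems.CollisionIsometryCLTAdaptedWeightCLTTLReductionDictionary
import Mathlib.Algebra.Order.Chebyshev

/-!
# Stub `stub_pastDamping` of the line `contact-source-duhamel` — helper file: DOUBLE STOCHASTICITY of
the carrier masses, and PAST = MEAN + REMAINDER probe by probe (crux `CollisionIsometryCLT.AdaptedWeightCLT`,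
stmt-AtomisticToContinuum-14868, `--supports`)

First block: the incoherent transport FIXES THE CONSTANT IDENTITY FAMILY, `𝒯 (k ↦ 𝟙) = (i ↦ 𝟙)`
(`tTransport_const_oneT`: `Q 𝟙 Qᵀ + P 𝟙 Pᵀ = Q + P = 𝟙`), so the basis carrier masses
`ω_{ki} = Σ_c massAt … k e_c i` (`omegaAt`) have ROW SUMS `3` (`sum_sites_basis_massAt`) besides the
column sums `3` of `…TLPastDampingMasses.lean` — doubly stochastic weights, `massAt … k a i ≤ ‖a‖² ω_{ki}`.
Second block: reading the site decomposition `PAST(C) = (N+1)⁻¹ Σ_k Σ_i w_i ⟨C, 𝒯(δ_k a_k^{⊗r})_i⟩`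
(`a_k = v_k − u`) with the weight of the SOURCE instead of the carrier's gives `PAST = M + R`,
`M(C) = (N+1)⁻¹ Σ_k w_k ⟨C, cloud_k(a_k)⟩`, `R(C) = (N+1)⁻¹ Σ_k Σ_i (w_i − w_k) ⟨C, 𝒯(δ_k a_k^{⊗r})_i⟩`
(`pastF_eq_mterm_add_rterm`). The mean term sees only CLOUDS (column sums): by the polarisations of
`…TLPastDampingAlgebra` (`cloud_two/three_polarization`) and tracelessness of the stress tests,
`|⟨C2, cloud_k(a)⟩| ≤ 5‖a‖² Σ_{pq} ‖cloud_k(d_pq) − iso2‖`, `|⟨C3, cloud_k(a)⟩| ≤ 3‖a‖³ Σ_p ‖cloud³_k(u_p)‖`,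
controlled by the PER-SITE DEPOLARISATION DEFECTS `dep2`, `dep3` (`cd2 = (N+1)⁻¹ Σ_k dep2`,
`cd3x = (N+1)⁻¹ Σ_k dep3`, `0 ≤ dep2 ≤ 6`, `0 ≤ dep3 ≤ 78`); the remainder is read carrier by carrier in
`…TLPastDampingPointwise.lean`.
-/

namespace Summit.AtomisticToContinuum.HydrodynamicLimit.Theorems.ContactSourceDuhamel.TimeLocal
namespace PastDamping

open scoped BigOperators Topology Classical MeasureTheory ENNReal InnerProductSpace
open Filter Set MeasureTheory
open Duhamel
open Summit.AtomisticToContinuum.HydrodynamicLimit.Theorems.AdaptedWeightCLTNegative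

noncomputable section

variable {σ : ℝ} {N : ℕ} {y : Cfg N}

/-! ## The identity tensor and the complementary projections -/

/-- The rank-2 identity tensor `𝟙`. -/
def oneT : Tens 2 := fun idx => if idx 0 = idx 1 then 1 else 0

/-- `𝟙 = Σ_c e_c ⊗ e_c` (`AdaptedWeightCLTNegative.sum_tpow_two_baseV`). -/
theorem oneT_eq_sum_tpow_baseV : oneT = ∑ c : Fin 3, tpow 2 (baseV c) := by
  rw [sum_tpow_two_baseV]
  rfl

/-- `tr 𝟙 = 3`. -/
theorem trT_oneT : trT oneT = 3 := by
  simp only [trT, oneT, Matrix.cons_val_zero, Matrix.cons_val_one, if_true, Fin.sum_univ_three]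
  norm_num

/-- `P` is idempotent: `P (P v) = P v`. -/
theorem projV_projV (n v : V3) : projV n (projV n v) = projV n v := by
  by_cases hn : n = 0
  · simp [projV, hn]
  · have hn2 : ‖n‖ ^ 2 ≠ 0 := pow_ne_zero 2 (norm_ne_zero_iff.2 hn)
    simp only [projV, real_inner_smul_right, real_inner_self_eq_norm_sq]
    congr 1
    field_simp

/-- `P Q = 0`: `P (Q v) = 0`. -/
theorem projV_coprojV (n v : V3) : projV n (coprojV n v) = 0 := by
  have h : projV n (coprojV n v) = projL n (v - projV n v) := rfl
  rw [h, map_sub, projL_apply, projL_apply, projV_projV, sub_self]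

/-- `Q` is idempotent: `Q (Q v) = Q v`. -/
theorem coprojV_coprojV (n v : V3) : coprojV n (coprojV n v) = coprojV n v := by
  conv_lhs => rw [coprojV]
  rw [projV_coprojV, sub_zero]

/-- `Q v + P v = v`. -/
theorem coprojV_add_projV (n v : V3) : coprojV n v + projV n v = v := by
  rw [coprojV, sub_add_cancel]

/-- The matrix `coprojM n` is symmetric. -/
theorem coprojM_symm (n : V3) (a b : Fin 3) : coprojM n a b = coprojM n b a := by
  simp only [coprojM, mul_comm, eq_comm]
/-- The matrix `projM n` is symmetric. -/
theorem projM_symm (n : V3) (a b : Fin 3) : projM n a b = projM n b a := by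
  simp only [projM, mul_comm]

/-- A column of `coprojM n` is `Q` of the basis vector. -/
theorem coprojM_col (n : V3) (i j : Fin 3) : coprojM n i j = coprojV n (baseV j) i := by
  rw [← coprojM_mulVec]
  simp only [baseV_apply, mul_ite, mul_one, mul_zero, Finset.sum_ite_eq', Finset.mem_univ, if_true]

/-- A column of `projM n` is `P` of the basis vector. -/
theorem projM_col (n : V3) (i j : Fin 3) : projM n i j = projV n (baseV j) i := by
  rw [← projM_mulVec]
  simp only [baseV_apply, mul_ite, mul_one, mul_zero, Finset.sum_ite_eq', Finset.mem_univ, if_true]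

/-- `mapT M 𝟙 = M Mᵀ`, entrywise. -/
theorem mapT_oneT (M : Mat3) (idx : Fin 2 → Fin 3) :
    mapT M oneT idx = ∑ c : Fin 3, M (idx 0) c * M (idx 1) c := by
  rw [mapT, sum_index_two]
  refine Finset.sum_congr rfl fun i _ => ?_
  simp only [oneT, Fin.prod_univ_two, Matrix.cons_val_zero, Matrix.cons_val_one, mul_ite, mul_one,
    mul_zero, Finset.sum_ite_eq, Finset.mem_univ, if_true]

/-- `Q 𝟙 Qᵀ = Q`, read through `coprojV`. -/
theorem mapT_coprojM_oneT (n : V3) (idx : Fin 2 → Fin 3) :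
    mapT (coprojM n) oneT idx = coprojV n (baseV (idx 1)) (idx 0) := by
  rw [mapT_oneT]
  have h : ∀ c : Fin 3, coprojM n (idx 0) c * coprojM n (idx 1) c =
      coprojM n (idx 0) c * coprojV n (baseV (idx 1)) c := by
    intro c
    rw [coprojM_symm n (idx 1) c, coprojM_col n c (idx 1)]
  simp only [h]
  rw [coprojM_mulVec, coprojV_coprojV]

/-- `P 𝟙 Pᵀ = P`, read through `projV`. -/
theorem mapT_projM_oneT (n : V3) (idx : Fin 2 → Fin 3) :
    mapT (projM n) oneT idx = projV n (baseV (idx 1)) (idx 0) := by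
  rw [mapT_oneT]
  have h : ∀ c : Fin 3, projM n (idx 0) c * projM n (idx 1) c =
      projM n (idx 0) c * projV n (baseV (idx 1)) c := by
    intro c
    rw [projM_symm n (idx 1) c, projM_col n c (idx 1)]
  simp only [h]
  rw [projM_mulVec, projV_projV]

/-- **`Q 𝟙 Qᵀ + P 𝟙 Pᵀ = 𝟙`**: one transport step fixes the identity tensor. -/
theorem mapT_coprojM_add_projM_oneT (n : V3) :
    mapT (coprojM n) oneT + mapT (projM n) oneT = oneT := by
  funext idx
  rw [Pi.add_apply, mapT_coprojM_oneT, mapT_projM_oneT, ← PiLp.add_apply, coprojV_add_projV,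
    baseV_apply, oneT]

/-! ## The transport fixes the constant identity family -/

/-- One transport step fixes the constant family `k ↦ 𝟙`. -/
theorem tStep_const_oneT (k : ℕ) :
    tStep 2 σ N y k (fun _ : Fin (N + 1) => oneT) = fun _ => oneT := by
  rcases h : stepPair σ N y k with _ | ⟨p, q⟩
  · exact tStep_of_none h _
  · rw [tStep_of_some h, mapT_coprojM_add_projM_oneT]
    funext j
    simp only [Function.update_apply]
    split_ifs <;> rfl

/-- **The window transport fixes the constant identity family** `𝒯 (k ↦ 𝟙) = (i ↦ 𝟙)`. -/
theorem tTransport_const_oneT (m₁ m : ℕ) :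
    tTransport 2 σ N y m₁ m (fun _ : Fin (N + 1) => oneT) = fun _ => oneT := by
  induction m with
  | zero => exact tTransport_zero m₁ _
  | succ m ih => rw [tTransport_succ, ih, tStep_const_oneT]

/-- Summed over the injection sites, the one-site transports of `𝟙` rebuild `𝟙` on every carrier. -/
theorem sum_sites_tTransport_oneT (m₁ m : ℕ) (i : Fin (N + 1)) :
    ∑ k : Fin (N + 1), tTransport 2 σ N y m₁ m (Pi.single k oneT) i = oneT := by
  have h := tTransport_eq_sum_single (r := 2) (σ := σ) (y := y) m₁ m (fun _ : Fin (N + 1) => oneT)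
  rw [tTransport_const_oneT] at h
  have hi := congrFun h i
  rw [Finset.sum_apply] at hi
  exact hi.symm

/-! ## Double stochasticity of the carrier masses -/

/-- **Row sums.** For every carrier `i`: `Σ_k Σ_c massAt … k e_c i = 3` (with the column sums
`Σ_i massAt … k a i = ‖a‖²` the basis masses are DOUBLY STOCHASTIC up to the factor `3`). -/
theorem sum_sites_basis_massAt (σ : ℝ) (N : ℕ) (y : Cfg N) (m : ℕ) (i : Fin (N + 1)) :
    ∑ k : Fin (N + 1), ∑ c : Fin 3, massAt σ N y m k (baseV c) i = 3 := by
  have h : ∀ k : Fin (N + 1), ∑ c : Fin 3, massAt σ N y m k (baseV c) i =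
      trT (tTransport 2 σ N y 0 m (Pi.single k oneT) i) := by
    intro k
    simp only [massAt]
    rw [← trT_sum, ← Finset.sum_apply, ← tTransport_single_sum, ← oneT_eq_sum_tpow_baseV]
  simp only [h]
  rw [← trT_sum, ← Finset.sum_apply] -- trT (Σ_k 𝒯(δ_k 𝟙)) i ... as a function sum
  have h2 : (∑ k : Fin (N + 1), tTransport 2 σ N y 0 m (Pi.single k oneT)) i =
      ∑ k : Fin (N + 1), tTransport 2 σ N y 0 m (Pi.single k oneT) i := Finset.sum_apply _ _ _
  rw [h2, sum_sites_tTransport_oneT, trT_oneT]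

/-! ## The basis carrier masses `ω` are doubly stochastic -/

/-- ROW SUMS: `Σ_k ω_{ki} = 3` — with the column sums of `…TLPastDampingMasses.lean` the basis carrier
masses `omegaAt` are DOUBLY STOCHASTIC (up to the factor `3`). -/
theorem sum_sites_omegaAt (m : ℕ) (i : Fin (N + 1)) : ∑ k, omegaAt σ N y m k i = 3 :=
  sum_sites_basis_massAt σ N y m i

/-- Registered anchor of this helper file (the row sums `sum_sites_basis_massAt`, with `massAt` and
`trT` unfolded). -/
theorem pastDamping_stochastic_anchor : ∀ (σ : ℝ) (N : ℕ) (y : Cfg N) (m : ℕ) (i : Fin (N + 1)), ∑ k : Fin (N + 1), ∑ c : Fin 3, ∑ d : Fin 3, tTransport 2 σ N y 0 m (Pi.single k (tpow 2 (baseV c))) i ![d, d] = 3 :=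
  sum_sites_basis_massAt

end

end PastDamping
end Summit.AtomisticToContinuum.HydrodynamicLimit.Theorems.ContactSourceDuhamel.TimeLocal

namespace Summit.AtomisticToContinuum.HydrodynamicLimit.Theorems.ContactSourceDuhamel.TimeLocal
namespace PastDamping

open scoped BigOperators Topology Classical MeasureTheory ENNReal InnerProductSpace
open Filter Set MeasureTheory
open Duhamel
open Summit.AtomisticToContinuum.HydrodynamicLimit.Theorems.AdaptedWeightCLTNegative (pairT_smul)
open ColumnDepolarisation (normSqT_nonneg normSqT_cloud_two_sub_iso2_le normSqT_cloud_three_le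
  norm_dirV sum_norm_udir_pow_six)

noncomputable section

variable {σ : ℝ} {N : ℕ} {y : Cfg N} {r : ℕ}

/-! ## PAST = MEAN (weights on the source) + REMAINDER (weight increments) -/

/-- The MEAN TERM of PAST: every cloud read with the weight of its source,
`M(C) = (N+1)⁻¹ Σ_k w_k ⟨C, cloud_k((v_k − u)^{⊗r})⟩`. -/
def mterm (r : ℕ) (σ : ℝ) (N : ℕ) (y : Cfg N) (m : ℕ) (w : Fin (N + 1) → ℝ) (u : V3)
    (C : Tens r) : ℝ :=
  ((N + 1 : ℕ) : ℝ)⁻¹ * ∑ k, w k * pairT C (cloud r σ N y m k ((y k).2 - u))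

/-- The REMAINDER of PAST: the one-site transports read with the weight increments between carrier
and source, `R(C) = (N+1)⁻¹ Σ_k Σ_i (w_i − w_k) ⟨C, 𝒯(δ_k (v_k − u)^{⊗r})_i⟩`. -/
def rterm (r : ℕ) (σ : ℝ) (N : ℕ) (y : Cfg N) (m : ℕ) (w : Fin (N + 1) → ℝ) (u : V3)
    (C : Tens r) : ℝ :=
  ((N + 1 : ℕ) : ℝ)⁻¹ * ∑ k, ∑ i, (w i - w k) *
    pairT C (tTransport r σ N y 0 m (Pi.single k (tpow r ((y k).2 - u))) i)

/-- **PAST = MEAN + REMAINDER.** -/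
theorem pastF_eq_mterm_add_rterm (r : ℕ) (σ : ℝ) (N : ℕ) (y : Cfg N) (m : ℕ) (w : Fin (N + 1) → ℝ)
    (u : V3) (C : Tens r) :
    pastF r σ N y m w u C = mterm r σ N y m w u C + rterm r σ N y m w u C := by
  rw [pastF_eq_sum_sites, mterm, rterm, ← mul_add, ← Finset.sum_add_distrib]
  congr 1
  refine Finset.sum_congr rfl fun k _ => ?_
  rw [cloud_eq, pairT_sum_right, Finset.mul_sum, ← Finset.sum_add_distrib]
  exact Finset.sum_congr rfl fun i _ => by ring

/-! ## Per-site depolarisation defects -/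

/-- The rank-2 DEPOLARISATION DEFECT of site `k`: `Σ_{pq} ‖cloud_k(d_pq) − |d|²𝟙/3‖²` (so that
`cd2 = (N+1)⁻¹ Σ_k dep2`). -/
def dep2 (σ : ℝ) (N : ℕ) (y : Cfg N) (m : ℕ) (k : Fin (N + 1)) : ℝ :=
  ∑ p : Fin 3, ∑ q : Fin 3, normSqT (cloud 2 σ N y m k (dirV p q) - iso2 (dirV p q))

/-- The rank-3 DEPOLARISATION DEFECT of site `k`: `Σ_p ‖cloud³_k(u_p)‖²` over the ten cubic probes (so
that `cd3x = (N+1)⁻¹ Σ_k dep3`). -/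
def dep3 (σ : ℝ) (N : ℕ) (y : Cfg N) (m : ℕ) (k : Fin (N + 1)) : ℝ :=
  ∑ p : Fin 10, normSqT (cloud 3 σ N y m k (udir p))

/-- `0 ≤ dep2`. -/
theorem dep2_nonneg (m : ℕ) (k : Fin (N + 1)) : 0 ≤ dep2 σ N y m k :=
  Finset.sum_nonneg fun _ _ => Finset.sum_nonneg fun _ _ => normSqT_nonneg _
/-- `0 ≤ dep3`. -/
theorem dep3_nonneg (m : ℕ) (k : Fin (N + 1)) : 0 ≤ dep3 σ N y m k :=
  Finset.sum_nonneg fun _ _ => normSqT_nonneg _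

/-- `dep2 ≤ 6` (nine unit probes, each cloud within `2/3` of isotropy). -/
theorem dep2_le (m : ℕ) (k : Fin (N + 1)) : dep2 σ N y m k ≤ 6 := by
  unfold dep2
  have hb : ∀ p q : Fin 3, normSqT (cloud 2 σ N y m k (dirV p q) - iso2 (dirV p q)) ≤ 2 / 3 := by
    intro p q
    have h := normSqT_cloud_two_sub_iso2_le (σ := σ) (y := y) m k (dirV p q)
    rw [norm_dirV] at h
    norm_num at h
    exact h
  calc ∑ p : Fin 3, ∑ q : Fin 3, normSqT (cloud 2 σ N y m k (dirV p q) - iso2 (dirV p q))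
      ≤ ∑ _p : Fin 3, ∑ _q : Fin 3, (2 / 3 : ℝ) :=
        Finset.sum_le_sum fun p _ => Finset.sum_le_sum fun q _ => hb p q
    _ = 6 := by simp only [Finset.sum_const, Finset.card_univ, Fintype.card_fin]; norm_num

/-- `dep3 ≤ 78`. -/
theorem dep3_le (m : ℕ) (k : Fin (N + 1)) : dep3 σ N y m k ≤ 78 := by
  unfold dep3
  rw [← sum_norm_udir_pow_six]
  exact Finset.sum_le_sum fun p _ => normSqT_cloud_three_le m k (udir p)

/-- `cd2` is the average of the per-site rank-2 defects. -/
theorem cd2_eq_avg_dep2 (Δ : ℝ) :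
    cd2 σ N y Δ = ((N + 1 : ℕ) : ℝ)⁻¹ * ∑ k, dep2 σ N y (steps σ N y Δ) k := rfl

/-- `cd3x` is the average of the per-site rank-3 defects. -/
theorem cd3x_eq_avg_dep3 (Δ : ℝ) :
    cd3x σ N y Δ = ((N + 1 : ℕ) : ℝ)⁻¹ * ∑ k, dep3 σ N y (steps σ N y Δ) k := rfl

/-! ## The clouds are linear in the injected tensor: polarisation -/

/-- The cloud is additive in the injected tensor (through `tpow`-free linearity of the transport). -/
theorem cloud_sum_smul {ι : Type*} (r : ℕ) (m : ℕ) (k : Fin (N + 1)) (s : Finset ι) (c : ι → ℝ)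
    (b : ι → V3) (a : V3) (h : tpow r a = ∑ l ∈ s, c l • tpow r (b l)) :
    cloud r σ N y m k a = ∑ l ∈ s, c l • cloud r σ N y m k (b l) := by
  rw [cloud_eq, h, tTransport_single_sum]
  simp only [tTransport_single_smul, Finset.sum_apply, Pi.smul_apply]
  rw [Finset.sum_comm]
  refine Finset.sum_congr rfl fun l _ => ?_
  rw [cloud_eq, Finset.smul_sum]

/-- **Rank-2 polarisation of the cloud**: `cloud_k(a ⊗ a) = Σ_{pq} c₂(a)_{pq} cloud_k(d_pq ⊗ d_pq)`. -/
theorem cloud_two_polarization (m : ℕ) (k : Fin (N + 1)) (a : V3) :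
    cloud 2 σ N y m k a = ∑ pq : Fin 3 × Fin 3, c2coef a pq.1 pq.2 • cloud 2 σ N y m k (dirV pq.1 pq.2) := by
  refine cloud_sum_smul 2 m k Finset.univ (fun pq : Fin 3 × Fin 3 => c2coef a pq.1 pq.2)
    (fun pq => dirV pq.1 pq.2) a ?_
  rw [tpow_two_polarization a, ← Finset.sum_product']
  rfl

/-- **Rank-3 polarisation of the cloud**: `cloud_k(a^{⊗3}) = Σ_p c₃(a)_p cloud_k(u_p^{⊗3})`. -/
theorem cloud_three_polarization (m : ℕ) (k : Fin (N + 1)) (a : V3) :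
    cloud 3 σ N y m k a = ∑ p : Fin 10, c3coef a p • cloud 3 σ N y m k (udir p) :=
  cloud_sum_smul 3 m k Finset.univ (c3coef a) udir a (tpow_three_eq_sum_udir a)

/-! ## The mean term read through the probes -/

/-- `‖C2 j k‖_F ≤ 1` in square-root form. -/
theorem sqrt_normSqT_C2_le (j k : Fin 3) : Real.sqrt (normSqT (C2 j k)) ≤ 1 := by
  rw [← Real.sqrt_one]
  refine Real.sqrt_le_sqrt ?_
  unfold normSqT
  rw [Reduction.sum_tens_two]
  simp only [C2, Matrix.cons_val_zero, Matrix.cons_val_one, Fin.sum_univ_three]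
  fin_cases j <;> fin_cases k <;> simp <;> norm_num

/-- `‖C3 a‖_F ≤ 1` in square-root form. -/
theorem sqrt_normSqT_C3_le (a : Fin 3) : Real.sqrt (normSqT (C3 a)) ≤ 1 := by
  rw [← Real.sqrt_one]
  refine Real.sqrt_le_sqrt ?_
  unfold normSqT
  rw [Reduction.sum_tens_three]
  simp only [C3, Matrix.cons_val_zero, Matrix.cons_val_one, Fin.sum_univ_three]
  fin_cases a <;> simp <;> norm_num

/-- **The stress tests read a cloud through its depolarisation defect**:
`|⟨C2 j k', cloud_k(a ⊗ a)⟩| ≤ 5‖a‖² Σ_{pq} ‖cloud_k(d_pq ⊗ d_pq) − |d_pq|²𝟙/3‖`. -/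
theorem abs_pairT_C2_cloud_le (j k' : Fin 3) (m : ℕ) (k : Fin (N + 1)) (a : V3) :
    |pairT (C2 j k') (cloud 2 σ N y m k a)| ≤ 5 * ‖a‖ ^ 2 *
      ∑ pq : Fin 3 × Fin 3, Real.sqrt (normSqT (cloud 2 σ N y m k (dirV pq.1 pq.2) - iso2 (dirV pq.1 pq.2))) := by
  rw [cloud_two_polarization, pairT_sum_right, Finset.mul_sum]
  refine (Finset.abs_sum_le_sum_abs _ _).trans (Finset.sum_le_sum fun pq _ => ?_)
  rw [pairT_smul, pairT_C2_eq_sub_iso2 j k' _ (dirV pq.1 pq.2), abs_mul]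
  refine mul_le_mul (abs_c2coef_le a pq.1 pq.2) ?_ (abs_nonneg _) (by positivity)
  refine (ColumnDepolarisation.abs_pairT_le _ _).trans ?_
  exact mul_le_of_le_one_left (Real.sqrt_nonneg _) (sqrt_normSqT_C2_le j k')

/-- **The heat-flux tests read a cubic cloud through the ten probed ones**:
`|⟨C3 a₀, cloud_k(a^{⊗3})⟩| ≤ 3‖a‖³ Σ_p ‖cloud³_k(u_p)‖`. -/
theorem abs_pairT_C3_cloud_le (a₀ : Fin 3) (m : ℕ) (k : Fin (N + 1)) (a : V3) :
    |pairT (C3 a₀) (cloud 3 σ N y m k a)| ≤ 3 * ‖a‖ ^ 3 *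
      ∑ p : Fin 10, Real.sqrt (normSqT (cloud 3 σ N y m k (udir p))) := by
  rw [cloud_three_polarization, pairT_sum_right, Finset.mul_sum]
  refine (Finset.abs_sum_le_sum_abs _ _).trans (Finset.sum_le_sum fun p _ => ?_)
  rw [pairT_smul, abs_mul]
  refine mul_le_mul (abs_c3coef_le a p) ?_ (abs_nonneg _) (by positivity)
  refine (ColumnDepolarisation.abs_pairT_le _ _).trans ?_
  exact mul_le_of_le_one_left (Real.sqrt_nonneg _) (sqrt_normSqT_C3_le a₀)

/-- The squared sum of the nine rank-2 root-defects is at most `9 dep2`. -/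
theorem sq_sum_sqrt_le_dep2 (m : ℕ) (k : Fin (N + 1)) :
    (∑ pq : Fin 3 × Fin 3, Real.sqrt (normSqT (cloud 2 σ N y m k (dirV pq.1 pq.2) - iso2 (dirV pq.1 pq.2)))) ^ 2
      ≤ 9 * dep2 σ N y m k := by
  refine (sq_sum_le_card_mul_sum_sq (s := Finset.univ)
    (f := fun pq : Fin 3 × Fin 3 => Real.sqrt (normSqT (cloud 2 σ N y m k (dirV pq.1 pq.2) -
      iso2 (dirV pq.1 pq.2))))).trans (le_of_eq ?_)
  rw [Finset.card_univ, Fintype.card_prod, Fintype.card_fin, dep2, ← Finset.sum_product']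
  simp only [Real.sq_sqrt (normSqT_nonneg _), Finset.univ_product_univ]
  norm_num

/-- The squared sum of the ten rank-3 root-defects is at most `10 dep3`. -/
theorem sq_sum_sqrt_le_dep3 (m : ℕ) (k : Fin (N + 1)) :
    (∑ p : Fin 10, Real.sqrt (normSqT (cloud 3 σ N y m k (udir p)))) ^ 2 ≤ 10 * dep3 σ N y m k := by
  refine (sq_sum_le_card_mul_sum_sq (s := Finset.univ)
    (f := fun p : Fin 10 => Real.sqrt (normSqT (cloud 3 σ N y m k (udir p))))).trans (le_of_eq ?_)
  rw [Finset.card_univ, Fintype.card_fin, dep3]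
  simp only [Real.sq_sqrt (normSqT_nonneg _)]
  norm_num

/-- Registered anchor of this helper file (`cd2` is the average of the per-site defects, with `dep2`
unfolded). -/
theorem pastDamping_decomposition_anchor : ∀ (σ : ℝ) (N : ℕ) (y : Cfg N) (Δ : ℝ), cd2 σ N y Δ = ((N + 1 : ℕ) : ℝ)⁻¹ * ∑ k : Fin (N + 1), ∑ p : Fin 3, ∑ q : Fin 3, normSqT (cloud 2 σ N y (steps σ N y Δ) k (dirV p q) - iso2 (dirV p q)) :=
  fun _ _ _ _ => rfl

end

end PastDamping
end Summit.AtomisticToContinuum.HydrodynamicLimit.Theorems.ContactSourceDuhamel.TimeLocal
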